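import Summits.CriticalPhenomena.PercolationContinuityZ3.Theorems.PercNearOneGluingNoHeavyLowerTailKnQuestion8CoefficientwiseCoreClassKernelMixHubPathPrep
import HarnessLib

/-!
# Runs of a word: the wall formulas are the intrinsic runs (PATH LEMMA of hub-Kleitman, interface to cluster traces)

Support file (`--supports stmt-CriticalPhenomena-4575`, closed), prover `prim-cplus-coupling` (gen 51).  No definitions, no notations,
no named facts, no sorries; standard axioms.  Memo `prim-cplus-coupling/A5-COUPLING-gen51.md` §1.3, §7(2).

The word-form path lemmas (`…KernelMixHubPathJGate`, `…HubPathJU`, `…HubPathFlip`) take the four runs of a word `ω ⊆ [1, ℓ]` through their WALL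
FORMULAS (`ri ω = min D(ω)` or `ℓ` for a red start, `0` for a blue start, etc.).  On a thread of a bundle the cluster traces give the runs
INTRINSICALLY (`C_u ∩ thread = {w₀, …, w_i}` with `e₁, …, e_i` red and `e_{i+1}` blue, `…KernelMixBundleWords`).  This file identifies the two:
* `hubPath_ri_spec` / `hubPath_ra_spec` / `hubPath_rj_spec` / `hubPath_rb_spec` — the wall-formula values satisfy the intrinsic characterisations
  (`[1, ri] ⊆ ω`, `ri = ℓ ∨ ri + 1 ∉ ω`; `[1, ra] ∩ ω = ∅`, `ra = ℓ ∨ ra + 1 ∈ ω`; mirror images for `rj`, `rb`);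
* `hubPath_lead_red_unique` / `hubPath_lead_blue_unique` / `hubPath_trail_red_unique` / `hubPath_trail_blue_unique` — the characterisations
  determine the runs.
[cite: KozmaNitzan2024, Questions 8–9 (§5.5 p. 36) (context)]
-/

namespace Summit.CriticalPhenomena.PercolationContinuityZ3.Theorems

open Finset

namespace Coefficientwise

/-- The leading red run is determined by `[1,i] ⊆ ω` and `i = ℓ ∨ i+1 ∉ ω`. [folklore] -/
theorem hubPath_lead_red_unique (ℓ : ℕ) (ω : Finset ℕ) (i i' : ℕ)
    (hi : Icc 1 i ⊆ ω ∧ i ≤ ℓ ∧ (i = ℓ ∨ i + 1 ∉ ω)) (hi' : Icc 1 i' ⊆ ω ∧ i' ≤ ℓ ∧ (i' = ℓ ∨ i' + 1 ∉ ω)) : i = i' := by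
  by_contra hne
  rcases Nat.lt_or_gt_of_ne hne with h | h
  · rcases hi.2.2 with h1 | h1
    · omega
    · exact h1 (hi'.1 (Finset.mem_Icc.mpr ⟨by omega, by omega⟩))
  · rcases hi'.2.2 with h1 | h1
    · omega
    · exact h1 (hi.1 (Finset.mem_Icc.mpr ⟨by omega, by omega⟩))

/-- The leading blue run is determined by `[1,a] ∩ ω = ∅` and `a = ℓ ∨ a+1 ∈ ω`. [folklore] -/
theorem hubPath_lead_blue_unique (ℓ : ℕ) (ω : Finset ℕ) (a a' : ℕ)
    (ha : (∀ k ∈ Icc 1 a, k ∉ ω) ∧ a ≤ ℓ ∧ (a = ℓ ∨ a + 1 ∈ ω))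
    (ha' : (∀ k ∈ Icc 1 a', k ∉ ω) ∧ a' ≤ ℓ ∧ (a' = ℓ ∨ a' + 1 ∈ ω)) : a = a' := by
  by_contra hne
  rcases Nat.lt_or_gt_of_ne hne with h | h
  · rcases ha.2.2 with h1 | h1
    · omega
    · exact ha'.1 (a + 1) (Finset.mem_Icc.mpr ⟨by omega, by omega⟩) h1
  · rcases ha'.2.2 with h1 | h1
    · omega
    · exact ha.1 (a' + 1) (Finset.mem_Icc.mpr ⟨by omega, by omega⟩) h1

/-- The trailing red run is determined by `[ℓ+1-j, ℓ] ⊆ ω` and `j = ℓ ∨ ℓ-j ∉ ω`. [folklore] -/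
theorem hubPath_trail_red_unique (ℓ : ℕ) (ω : Finset ℕ) (j j' : ℕ)
    (hj : Icc (ℓ + 1 - j) ℓ ⊆ ω ∧ j ≤ ℓ ∧ (j = ℓ ∨ ℓ - j ∉ ω))
    (hj' : Icc (ℓ + 1 - j') ℓ ⊆ ω ∧ j' ≤ ℓ ∧ (j' = ℓ ∨ ℓ - j' ∉ ω)) : j = j' := by
  by_contra hne
  rcases Nat.lt_or_gt_of_ne hne with h | h
  · rcases hj.2.2 with h1 | h1
    · omega
    · exact h1 (hj'.1 (Finset.mem_Icc.mpr ⟨by omega, by omega⟩))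
  · rcases hj'.2.2 with h1 | h1
    · omega
    · exact h1 (hj.1 (Finset.mem_Icc.mpr ⟨by omega, by omega⟩))

/-- The trailing blue run is determined by `[ℓ+1-b, ℓ] ∩ ω = ∅` and `b = ℓ ∨ ℓ-b ∈ ω`. [folklore] -/
theorem hubPath_trail_blue_unique (ℓ : ℕ) (ω : Finset ℕ) (b b' : ℕ)
    (hb : (∀ k ∈ Icc (ℓ + 1 - b) ℓ, k ∉ ω) ∧ b ≤ ℓ ∧ (b = ℓ ∨ ℓ - b ∈ ω))
    (hb' : (∀ k ∈ Icc (ℓ + 1 - b') ℓ, k ∉ ω) ∧ b' ≤ ℓ ∧ (b' = ℓ ∨ ℓ - b' ∈ ω)) : b = b' := by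
  by_contra hne
  rcases Nat.lt_or_gt_of_ne hne with h | h
  · rcases hb.2.2 with h1 | h1
    · omega
    · exact hb'.1 (ℓ - b) (Finset.mem_Icc.mpr ⟨by omega, by omega⟩) h1
  · rcases hb'.2.2 with h1 | h1
    · omega
    · exact hb.1 (ℓ - b') (Finset.mem_Icc.mpr ⟨by omega, by omega⟩) h1

/-- **The wall formula for the leading red run is the leading red run.** [folklore] -/
theorem hubPath_ri_spec (ℓ : ℕ) (hℓ : 1 ≤ ℓ) (D : Finset ℕ → Finset ℕ)
    (hD : ∀ ω, D ω = (Icc 1 (ℓ - 1)).filter (fun k => ¬ (k ∈ ω ↔ k + 1 ∈ ω))) (ri : Finset ℕ → ℕ)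
    (hri : ∀ ω, ri ω = if 1 ∈ ω then (if h : (D ω).Nonempty then (D ω).min' h else ℓ) else 0)
    (ω : Finset ℕ) : Icc 1 (ri ω) ⊆ ω ∧ ri ω ≤ ℓ ∧ (ri ω = ℓ ∨ ri ω + 1 ∉ ω) := by
  rw [hri]
  split_ifs with h1 hDn
  · have hm := walls_bounds ℓ D hD ω _ ((D ω).min'_mem hDn)
    refine ⟨fun k hk => ?_, by omega, Or.inr ?_⟩
    · have hkb := Finset.mem_Icc.mp hk
      exact (walls_run_left ℓ D hD ω hDn k hkb.1 hkb.2).mpr h1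
    · rw [walls_run_left_next ℓ D hD ω hDn]; exact fun h => h h1
  · rw [Finset.not_nonempty_iff_eq_empty] at hDn
    refine ⟨fun k hk => ?_, le_refl _, Or.inl rfl⟩
    have hkb := Finset.mem_Icc.mp hk
    exact ((walls_eq_empty_iff ℓ D hD ω).mp hDn k hkb.1 hkb.2).mpr h1
  · refine ⟨fun k hk => ?_, Nat.zero_le _, Or.inr (by simpa using h1)⟩
    have := Finset.mem_Icc.mp hk; omega

/-- **The wall formula for the leading blue run is the leading blue run.** [folklore] -/
theorem hubPath_ra_spec (ℓ : ℕ) (hℓ : 1 ≤ ℓ) (D : Finset ℕ → Finset ℕ)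
    (hD : ∀ ω, D ω = (Icc 1 (ℓ - 1)).filter (fun k => ¬ (k ∈ ω ↔ k + 1 ∈ ω))) (ra : Finset ℕ → ℕ)
    (hra : ∀ ω, ra ω = if 1 ∈ ω then 0 else (if h : (D ω).Nonempty then (D ω).min' h else ℓ))
    (ω : Finset ℕ) : (∀ k ∈ Icc 1 (ra ω), k ∉ ω) ∧ ra ω ≤ ℓ ∧ (ra ω = ℓ ∨ ra ω + 1 ∈ ω) := by
  rw [hra]
  split_ifs with h1 hDn
  · refine ⟨fun k hk => ?_, Nat.zero_le _, Or.inr (by simpa using h1)⟩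
    have := Finset.mem_Icc.mp hk; omega
  · have hm := walls_bounds ℓ D hD ω _ ((D ω).min'_mem hDn)
    refine ⟨fun k hk hkω => ?_, by omega, Or.inr ?_⟩
    · have hkb := Finset.mem_Icc.mp hk
      exact h1 ((walls_run_left ℓ D hD ω hDn k hkb.1 hkb.2).mp hkω)
    · exact (walls_run_left_next ℓ D hD ω hDn).mpr h1
  · rw [Finset.not_nonempty_iff_eq_empty] at hDn
    refine ⟨fun k hk hkω => ?_, le_refl _, Or.inl rfl⟩
    have hkb := Finset.mem_Icc.mp hk
    exact h1 (((walls_eq_empty_iff ℓ D hD ω).mp hDn k hkb.1 hkb.2).mp hkω)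

/-- **The wall formula for the trailing red run is the trailing red run.** [folklore] -/
theorem hubPath_rj_spec (ℓ : ℕ) (hℓ : 1 ≤ ℓ) (D : Finset ℕ → Finset ℕ)
    (hD : ∀ ω, D ω = (Icc 1 (ℓ - 1)).filter (fun k => ¬ (k ∈ ω ↔ k + 1 ∈ ω))) (rj : Finset ℕ → ℕ)
    (hrj : ∀ ω, rj ω = if ℓ ∈ ω then (if h : (D ω).Nonempty then ℓ - (D ω).max' h else ℓ) else 0)
    (ω : Finset ℕ) : Icc (ℓ + 1 - rj ω) ℓ ⊆ ω ∧ rj ω ≤ ℓ ∧ (rj ω = ℓ ∨ ℓ - rj ω ∉ ω) := by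
  rw [hrj]
  split_ifs with hl hDn
  · have hM := walls_bounds ℓ D hD ω _ ((D ω).max'_mem hDn)
    have e1 : ℓ + 1 - (ℓ - (D ω).max' hDn) = (D ω).max' hDn + 1 := by omega
    have e2 : ℓ - (ℓ - (D ω).max' hDn) = (D ω).max' hDn := by omega
    rw [e1, e2]
    refine ⟨fun k hk => ?_, by omega, Or.inr ?_⟩
    · have hkb := Finset.mem_Icc.mp hk
      exact (walls_run_right ℓ D hD ω hDn k hkb.1 hkb.2).mpr hl
    · rw [walls_run_right_prev ℓ D hD ω hDn]; exact fun h => h hl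
  · rw [Finset.not_nonempty_iff_eq_empty] at hDn
    have h1 : 1 ∈ ω := ((walls_eq_empty_iff ℓ D hD ω).mp hDn ℓ hℓ (le_refl _)).mp hl
    refine ⟨fun k hk => ?_, le_refl _, Or.inl rfl⟩
    have hkb := Finset.mem_Icc.mp hk
    exact ((walls_eq_empty_iff ℓ D hD ω).mp hDn k (by omega) hkb.2).mpr h1
  · refine ⟨fun k hk => ?_, Nat.zero_le _, Or.inr (by simpa using hl)⟩
    have := Finset.mem_Icc.mp hk; omega

/-- **The wall formula for the trailing blue run is the trailing blue run.** [folklore] -/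
theorem hubPath_rb_spec (ℓ : ℕ) (hℓ : 1 ≤ ℓ) (D : Finset ℕ → Finset ℕ)
    (hD : ∀ ω, D ω = (Icc 1 (ℓ - 1)).filter (fun k => ¬ (k ∈ ω ↔ k + 1 ∈ ω))) (rb : Finset ℕ → ℕ)
    (hrb : ∀ ω, rb ω = if ℓ ∈ ω then 0 else (if h : (D ω).Nonempty then ℓ - (D ω).max' h else ℓ))
    (ω : Finset ℕ) : (∀ k ∈ Icc (ℓ + 1 - rb ω) ℓ, k ∉ ω) ∧ rb ω ≤ ℓ ∧ (rb ω = ℓ ∨ ℓ - rb ω ∈ ω) := by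
  rw [hrb]
  split_ifs with hl hDn
  · refine ⟨fun k hk => ?_, Nat.zero_le _, Or.inr (by simpa using hl)⟩
    have := Finset.mem_Icc.mp hk; omega
  · have hM := walls_bounds ℓ D hD ω _ ((D ω).max'_mem hDn)
    have e1 : ℓ + 1 - (ℓ - (D ω).max' hDn) = (D ω).max' hDn + 1 := by omega
    have e2 : ℓ - (ℓ - (D ω).max' hDn) = (D ω).max' hDn := by omega
    rw [e1, e2]
    refine ⟨fun k hk hkω => ?_, by omega, Or.inr ?_⟩
    · have hkb := Finset.mem_Icc.mp hk
      exact hl ((walls_run_right ℓ D hD ω hDn k hkb.1 hkb.2).mp hkω)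
    · exact (walls_run_right_prev ℓ D hD ω hDn).mpr hl
  · rw [Finset.not_nonempty_iff_eq_empty] at hDn
    refine ⟨fun k hk hkω => ?_, le_refl _, Or.inl rfl⟩
    have hkb := Finset.mem_Icc.mp hk
    have h1 : 1 ∈ ω := ((walls_eq_empty_iff ℓ D hD ω).mp hDn k (by omega) hkb.2).mp hkω
    exact hl (((walls_eq_empty_iff ℓ D hD ω).mp hDn ℓ hℓ (le_refl _)).mpr h1)

end Coefficientwise

end Summit.CriticalPhenomena.PercolationContinuityZ3.Theorems
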